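import Summits.QuantumFields.YangMills.Theorems.BalabanUVNodesN16Eq04SameBlocksBasePointGauge
import Summits.QuantumFields.YangMills.Theorems.BalabanUVNodesN16Eq42PermutationDefectNonAbelian
import Summits.QuantumFields.YangMills.Theorems.BalabanUVNodesN16Eq42StencilLipschitz
import HarnessLib

/-!
# YM-DAG node N16 (NE3), the located averaging pin (42) ↔ (0.4) — part 22: SAME BLOCKS, DIFFERENT BASE POINTS, NON-ABELIAN — on the record's partition the
# (0.4)-shaped exponent (symmetrised stars from the base point `q+s`, exp-mean-log) differs from (42)'s exponent by an EXACT COARSE GRADIENT plus SECOND ORDER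
# `ρ₂(ℓ_s,a) + ρ₂(ℓ,a)` — NO `O(L³δ)` TERM (the quantitative form of `W3-PIN-ANATOMY-v4.md` §4 (i))

Cell `pub-ymgap`, width seat `pub-ymgap-dag-n16-w3` (director-ym №197 ∕ HUMAN RULING D-0149), generation 7; part 22 of the W1b lineage (part 3 p595773: `‖X − X̂‖ ≤ ρ₂(ℓ,a)`;
part 5 p597832: the symmetrised non-abelian recipe on CORNER base points, `≤ d(d+2)L³δ + 2ρ₂`; part 13 p614236: the LINEARISED (0.4) recipe with base point `q+s` on the
record's partition minus (42)'s is an EXACT coarse gradient, `X04_sub_Xhat_eq`).  `--kind proof --supports stmt-QuantumFields-27366 --as helper` (K3⁸; count-neutral;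
0 `def` — the recipe's sums are DISPLAYED).  `bears_on: R4∕N16`.

THE POINT.  g6 left un-typed «the non-abelian second-order statement at the record's base point (symmetrised exp-mean-log vs frame-conjugated (42), `≤ C·ρ₂`)».
For a group-valued configuration `V` written near the block as `V_b = e^{A_b}`, `‖A_b‖ ≤ a`:
 * §1 `length_symLoopOffset_le`: the (0.4)-shaped loops from the base point `q+s` — «`σ`-star to the block point, the transported segment, `σ′`-star back, the base
   segment back» — have length `≤ ℓ_s = 2(dL + |s|₁) + 2L`.
 * §2 `norm_symMean_mlog_sub_asum_le` (GENERIC: any `(r,σ,σ′)`-indexed family of words of length `≤ ℓ` read from one base point `p`): the symmetrised block mean of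
   `log V(Γ)` is within `ρ₂(ℓ,a) = ρ(2(e^{ℓa} − 1)) + ρ(ℓa)` of that of `A(Γ)` (part 3's `norm_mlog_hol_sub_asum_le` termwise; the normalised double mean does not
   increase norms; part 7's `l1_boxVec_sub_le` for the loop lengths); instance ★ `norm_X04avg_sub_X04hat_le` for the (0.4)-shaped exponent `X04avg_s[V](q,κ)` at base point `q+s` against its linearisation `X̂04_s[A]`.
 * §3 ★★ `norm_X04avg_sub_Xavg_sub_coarseGrad_le`: `‖X04avg_s[V](q,κ) − X[V](q,κ) − {[Λ_s(q) − Λ_s(q+Le_κ)] − [A_{q+s}(seg) − A_q(seg)]}‖ ≤ ρ₂(ℓ_s,a) + ρ₂(ℓ,a)` with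
   part 13's DISPLAYED site function `Λ_s` — the bracket is part 13's EXACT linear identity `X̂04_s − X̂ = [Λ_s(q) − Λ_s(q+Le_κ)] − [seg_s − seg_q]` (`X04_sub_Xhat_eq`), the
   two `ρ₂` are §2 and part 3's `norm_Xavg_sub_Xhat_le`.  So, PER STEP and in a local exponential gauge, the (0.4)-shaped exponent on the record's partition is
   (42)'s exponent moved by an exact coarse gradient (base-point change + base segments) up to SECOND ORDER ONLY — contrast parts 5∕9 (`+ d(d+2)L³δ`, the re-blocking
   geometry v4 corrected).  This quantifies `W3-PIN-ANATOMY-v4.md` §4 (i): what separates the pin from part 14's exact criterion is `O(ρ₂)` per step, gauge-INVARIANTLY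
   visible only at second order (part 18's trace test is where a witness would show it is not zero).
HONEST FRAMING.  [folklore] finite-sum bookkeeping BY NAME over parts 3∕13 and b07's word calculus; 0 `def`, 0 `sorry`; the local exponential representation is a DISPLAYED
hypothesis; nothing about minimisers; nothing of [Balaban1985Averaging] ∕ [Balaban1987RG1] asserted beyond what the tree proves; the torus-typed (0.4) OBJECT
(`BlockAveraging.blockAvg expMeanLogSU`, g0's `step04`) is not bridged here (g0's (d1)–(d3)); K3⁸ stubs NOT touched; N16 ∕ NE3 NOT discharged; count-neutral (typed 28∕28 ·
discharged 5∕27 work-bound, A 5∕28 — unmoved).  One finite four-torus programme at fixed `ε` — the Yang–Mills mass gap (Clay) is NOT proved by any of this; R4 closes the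
conditional finite-𝕋⁴ rung `BalabanLadder.UV` only; nothing continuum ∕ ℝ⁴ ∕ OS.
-/

set_option autoImplicit false

open scoped BigOperators
open NormedSpace Finset

namespace Summit.QuantumFields.YangMills.BalabanUVNodes.N16Eq04SameBlocksNonAbelian

open Literature.MathematicalPhysics.QuantumFieldTheory.Balaban1983to89
open B7Prop1Explicit
open B12ContourAverage253 (permWord disp_permWord length_permWord)
open Summit.QuantumFields.YangMills.BalabanUVNodes.N16Eq42PermutationDefectNonAbelian (norm_mlog_hol_sub_asum_le norm_Xavg_sub_Xhat_le)
open Summit.QuantumFields.YangMills.BalabanUVNodes.N16Eq04SameBlocksBasePointGauge (X04_sub_Xhat_eq)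
open Summit.QuantumFields.YangMills.BalabanUVNodes.N16Eq42StencilLipschitz (l1_boxVec_sub_le)

noncomputable section

variable {d : ℕ}
variable {𝔸 : Type*} [NormedRing 𝔸] [NormOneClass 𝔸] [NormedAlgebra ℂ 𝔸] [CompleteSpace 𝔸]

/-! ## §1 Lengths of the (0.4)-shaped loops read from the base point `q + s` -/

omit [NormOneClass 𝔸] [NormedAlgebra ℂ 𝔸] [CompleteSpace 𝔸] in
/-- The (0.4)-shaped loop from the base point `q+s` — `σ`-star to the block point, transported segment, `σ′`-star back, base segment back — has length
`≤ ℓ_s = 2(dL + |s|₁) + L + L`. [folklore] -/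
theorem length_symLoopOffset_le (L : ℕ) (κ : Fin d) (σ σ' : Equiv.Perm (Fin d)) (r : Fin d → Fin L) (s : Site d) :
    (permWord σ (boxVec L r - s) ++ seg κ L ++ revWord (permWord σ' (boxVec L r - s)) ++ seg κ (-(L : ℤ))).length ≤ 2 * (d * L + l1 s) + L + L := by
  simp only [List.length_append, length_permWord, length_revWord, length_seg, Int.natAbs_neg, Int.natAbs_natCast]
  have := l1_boxVec_sub_le L r s
  omega

/-! ## §2 Symmetrised block means of `log V(Γ)` against those of `A(Γ)` — generic, then the (0.4)-shaped exponent at base point `q+s` -/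

omit [NormOneClass 𝔸] in
/-- **GENERIC SECOND-ORDER BOUND FOR A SYMMETRISED BLOCK MEAN OF LOOP LOGARITHMS.**  For any family of words `w r σ σ′` of length `≤ ℓ` read from one base point `p`,
and `V_b = e^{A_b}`, `‖A_b‖ ≤ a` on the bonds within `|·|₁`-distance `ℓ` of `p`, `e^{ℓa} − 1 ≤ ½`:
`‖Σ_r L^{−d}•|Sym|^{−2}•Σ_{σ,σ′} log V_p(w) − Σ_r L^{−d}•|Sym|^{−2}•Σ_{σ,σ′} A_p(w)‖ ≤ ρ₂(ℓ,a)` (part 3 termwise; means do not increase norms; `1 ≤ L`). [folklore] -/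
theorem norm_symMean_mlog_sub_asum_le (L : ℕ) (hL : 1 ≤ L) (V : Site d → Fin d → 𝔸ˣ) (A : Site d → Fin d → 𝔸) (p : Site d)
    (w : (Fin d → Fin L) → Equiv.Perm (Fin d) → Equiv.Perm (Fin d) → List (Letter d)) (ℓ : ℕ) (hw : ∀ r σ σ', (w r σ σ').length ≤ ℓ)
    {a : ℝ} (ha : 0 ≤ a)
    (hVA : ∀ (x : Site d) (μ : Fin d), l1 (x - p) ≤ ℓ → ((V x μ : 𝔸ˣ) : 𝔸) = exp (A x μ) ∧ ‖A x μ‖ ≤ a)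
    (hsmall : Real.exp ((ℓ : ℝ) * a) - 1 ≤ 1 / 2) :
    ‖(∑ r : Fin d → Fin L, (((L : ℝ) ^ d)⁻¹) • ((((Fintype.card (Equiv.Perm (Fin d)) : ℝ) ^ 2)⁻¹) •
        ∑ σ : Equiv.Perm (Fin d), ∑ σ' : Equiv.Perm (Fin d), MatrixLog.mlog ((hol V p (w r σ σ') : 𝔸ˣ) : 𝔸)))
      - (∑ r : Fin d → Fin L, (((L : ℝ) ^ d)⁻¹) • ((((Fintype.card (Equiv.Perm (Fin d)) : ℝ) ^ 2)⁻¹) •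
        ∑ σ : Equiv.Perm (Fin d), ∑ σ' : Equiv.Perm (Fin d), asum A p (w r σ σ')))‖
      ≤ expRem (2 * (Real.exp ((ℓ : ℝ) * a) - 1)) + expRem ((ℓ : ℝ) * a) := by
  set B : ℝ := expRem (2 * (Real.exp ((ℓ : ℝ) * a) - 1)) + expRem ((ℓ : ℝ) * a) with hB
  set N : ℝ := (Fintype.card (Equiv.Perm (Fin d)) : ℝ) with hNdef
  have hN : N ≠ 0 := by rw [hNdef]; exact_mod_cast Fintype.card_ne_zero
  have hNpos : 0 < N := by rw [hNdef]; exact_mod_cast Fintype.card_pos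
  have hL0 : (0 : ℝ) < (L : ℝ) ^ d := pow_pos (by exact_mod_cast (by omega : 0 < L)) _
  have hB0 : 0 ≤ B := add_nonneg (expRem_nonneg _) (expRem_nonneg _)
  -- termwise second-order bound on every loop of the family
  have hterm : ∀ (r : Fin d → Fin L) (σ σ' : Equiv.Perm (Fin d)),
      ‖MatrixLog.mlog ((hol V p (w r σ σ') : 𝔸ˣ) : 𝔸) - asum A p (w r σ σ')‖ ≤ B := by
    intro r σ σ'
    have hlen : (w r σ σ').length ≤ ℓ := hw r σ σ'
    have hna : ((w r σ σ').length : ℝ) * a ≤ (ℓ : ℝ) * a := mul_le_mul_of_nonneg_right (by exact_mod_cast hlen) ha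
    have hexp : Real.exp ((w r σ σ').length * a) - 1 ≤ Real.exp ((ℓ : ℝ) * a) - 1 := by linarith [Real.exp_le_exp.mpr hna]
    have h := norm_mlog_hol_sub_asum_le V A p ℓ ha hVA (w r σ σ') p (by simp [l1]; exact hlen) (hexp.trans hsmall)
    refine h.trans (add_le_add (expRem_mono (by
        have := Real.one_le_exp (by positivity : (0 : ℝ) ≤ (w r σ σ').length * a); positivity) (by linarith))
      (expRem_mono (by positivity) hna))
  -- average: ‖mean of terms each ≤ B‖ ≤ B
  rw [← Finset.sum_sub_distrib]
  calc ‖∑ r : Fin d → Fin L, ((((L : ℝ) ^ d)⁻¹) • ((N ^ 2)⁻¹ • ∑ σ : Equiv.Perm (Fin d), ∑ σ' : Equiv.Perm (Fin d),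
            MatrixLog.mlog ((hol V p (w r σ σ') : 𝔸ˣ) : 𝔸))
          - (((L : ℝ) ^ d)⁻¹) • ((N ^ 2)⁻¹ • ∑ σ : Equiv.Perm (Fin d), ∑ σ' : Equiv.Perm (Fin d), asum A p (w r σ σ')))‖
      ≤ ∑ r : Fin d → Fin L, ‖(((L : ℝ) ^ d)⁻¹) • ((N ^ 2)⁻¹ • ∑ σ : Equiv.Perm (Fin d), ∑ σ' : Equiv.Perm (Fin d),
            MatrixLog.mlog ((hol V p (w r σ σ') : 𝔸ˣ) : 𝔸))
          - (((L : ℝ) ^ d)⁻¹) • ((N ^ 2)⁻¹ • ∑ σ : Equiv.Perm (Fin d), ∑ σ' : Equiv.Perm (Fin d), asum A p (w r σ σ'))‖ := norm_sum_le _ _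
    _ ≤ ∑ _r : Fin d → Fin L, ((L : ℝ) ^ d)⁻¹ * B := Finset.sum_le_sum fun r _ => by
        rw [← smul_sub, ← smul_sub, ← Finset.sum_sub_distrib, norm_smul, norm_inv, Real.norm_of_nonneg hL0.le]
        refine mul_le_mul_of_nonneg_left ?_ (by positivity)
        rw [norm_smul, norm_inv, norm_pow, Real.norm_of_nonneg hNpos.le]
        calc (N ^ 2)⁻¹ * ‖∑ σ : Equiv.Perm (Fin d), (∑ σ' : Equiv.Perm (Fin d), MatrixLog.mlog ((hol V p (w r σ σ') : 𝔸ˣ) : 𝔸)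
                - ∑ σ' : Equiv.Perm (Fin d), asum A p (w r σ σ'))‖
            ≤ (N ^ 2)⁻¹ * ∑ σ : Equiv.Perm (Fin d), ∑ σ' : Equiv.Perm (Fin d), B := by
              refine mul_le_mul_of_nonneg_left ((norm_sum_le _ _).trans (Finset.sum_le_sum fun σ _ => ?_)) (by positivity)
              rw [← Finset.sum_sub_distrib]
              exact (norm_sum_le _ _).trans (Finset.sum_le_sum fun σ' _ => hterm r σ σ')
          _ = B := by
              rw [Finset.sum_const, Finset.sum_const, Finset.card_univ, nsmul_eq_mul, nsmul_eq_mul, ← hNdef]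
              field_simp
    _ = B := by
        rw [Finset.sum_const, Finset.card_univ, Fintype.card_fun, Fintype.card_fin, Fintype.card_fin, nsmul_eq_mul]
        push_cast
        field_simp

omit [NormOneClass 𝔸] in
/-- **★ THE (0.4)-SHAPED EXPONENT AT BASE POINT `q+s` AGAINST ITS LINEARISATION**: for `V_b = e^{A_b}`, `‖A_b‖ ≤ a` within `|·|₁`-distance `ℓ_s = 2(dL+|s|₁)+2L` of `q+s`
and `e^{ℓ_s a} − 1 ≤ ½`: `‖X04avg_s[V](q,κ) − X̂04_s[A](q,κ)‖ ≤ ρ₂(ℓ_s,a)` (both sums DISPLAYED; §2 at the family of §1). [folklore] -/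
theorem norm_X04avg_sub_X04hat_le (L : ℕ) (hL : 1 ≤ L) (V : Site d → Fin d → 𝔸ˣ) (A : Site d → Fin d → 𝔸) (q s : Site d) (κ : Fin d)
    {a : ℝ} (ha : 0 ≤ a)
    (hVA : ∀ (x : Site d) (μ : Fin d), l1 (x - (q + s)) ≤ 2 * (d * L + l1 s) + L + L → ((V x μ : 𝔸ˣ) : 𝔸) = exp (A x μ) ∧ ‖A x μ‖ ≤ a)
    (hsmall : Real.exp (((2 * (d * L + l1 s) + L + L : ℕ) : ℝ) * a) - 1 ≤ 1 / 2) :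
    ‖(∑ r : Fin d → Fin L, (((L : ℝ) ^ d)⁻¹) • ((((Fintype.card (Equiv.Perm (Fin d)) : ℝ) ^ 2)⁻¹) •
        ∑ σ : Equiv.Perm (Fin d), ∑ σ' : Equiv.Perm (Fin d),
          MatrixLog.mlog ((hol V (q + s) (permWord σ (boxVec L r - s) ++ seg κ L ++ revWord (permWord σ' (boxVec L r - s)) ++ seg κ (-(L : ℤ))) : 𝔸ˣ) : 𝔸)))
      - (∑ r : Fin d → Fin L, (((L : ℝ) ^ d)⁻¹) • ((((Fintype.card (Equiv.Perm (Fin d)) : ℝ) ^ 2)⁻¹) •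
        ∑ σ : Equiv.Perm (Fin d), ∑ σ' : Equiv.Perm (Fin d),
          asum A (q + s) (permWord σ (boxVec L r - s) ++ seg κ L ++ revWord (permWord σ' (boxVec L r - s)) ++ seg κ (-(L : ℤ)))))‖
      ≤ expRem (2 * (Real.exp (((2 * (d * L + l1 s) + L + L : ℕ) : ℝ) * a) - 1)) + expRem (((2 * (d * L + l1 s) + L + L : ℕ) : ℝ) * a) :=
  norm_symMean_mlog_sub_asum_le L hL V A (q + s)
    (fun r σ σ' => permWord σ (boxVec L r - s) ++ seg κ L ++ revWord (permWord σ' (boxVec L r - s)) ++ seg κ (-(L : ℤ)))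
    (2 * (d * L + l1 s) + L + L) (fun r σ σ' => length_symLoopOffset_le L κ σ σ' r s) ha hVA hsmall

/-! ## §3 The (0.4)-shaped exponent at the record's base point against (42)'s: exact coarse gradient + second order -/

omit [NormOneClass 𝔸] in
/-- **★★ SAME BLOCKS, DIFFERENT BASE POINTS, NON-ABELIAN.**  For `V_b = e^{A_b}`, `‖A_b‖ ≤ a` within `ℓ_s` of `q+s` and within `ℓ = 2dL+2L` of `q` (`e^{ℓ_s a} − 1 ≤ ½`,
`e^{ℓa} − 1 ≤ ½`): the (0.4)-shaped non-abelian exponent at base point `q+s` on the block `q + [0,L)ᵈ` MINUS (42)'s exponent `X[V](q,κ)` MINUS the EXACT linear defect of part 13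
— `[Λ_s(q) − Λ_s(q+Le_κ)] − [A_{q+s}(seg) − A_q(seg)]`, `Λ_s(p) = Σ_r L^{−d}•|Sym|⁻¹•Σ_σ [A_{p+s}(permWord σ (r−s)) − A_p(treeWord r)]` (displayed) — has norm
`≤ ρ₂(ℓ_s,a) + ρ₂(ℓ,a)`: SECOND ORDER ONLY, no `O(L³δ)` term. [folklore] -/
theorem norm_X04avg_sub_Xavg_sub_coarseGrad_le (L : ℕ) (hL : 1 ≤ L) (V : Site d → Fin d → 𝔸ˣ) (A : Site d → Fin d → 𝔸) (q s : Site d) (κ : Fin d)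
    {a : ℝ} (ha : 0 ≤ a)
    (hVAs : ∀ (x : Site d) (μ : Fin d), l1 (x - (q + s)) ≤ 2 * (d * L + l1 s) + L + L → ((V x μ : 𝔸ˣ) : 𝔸) = exp (A x μ) ∧ ‖A x μ‖ ≤ a)
    (hVA : ∀ (x : Site d) (μ : Fin d), l1 (x - q) ≤ 2 * (d * L) + L + L → ((V x μ : 𝔸ˣ) : 𝔸) = exp (A x μ) ∧ ‖A x μ‖ ≤ a)
    (hsmalls : Real.exp (((2 * (d * L + l1 s) + L + L : ℕ) : ℝ) * a) - 1 ≤ 1 / 2)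
    (hsmall : Real.exp (((2 * (d * L) + L + L : ℕ) : ℝ) * a) - 1 ≤ 1 / 2) :
    ‖(∑ r : Fin d → Fin L, (((L : ℝ) ^ d)⁻¹) • ((((Fintype.card (Equiv.Perm (Fin d)) : ℝ) ^ 2)⁻¹) •
        ∑ σ : Equiv.Perm (Fin d), ∑ σ' : Equiv.Perm (Fin d),
          MatrixLog.mlog ((hol V (q + s) (permWord σ (boxVec L r - s) ++ seg κ L ++ revWord (permWord σ' (boxVec L r - s)) ++ seg κ (-(L : ℤ))) : 𝔸ˣ) : 𝔸)))
      - Xavg L V q κ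
      - (((∑ r : Fin d → Fin L, (((L : ℝ) ^ d)⁻¹) • ((((Fintype.card (Equiv.Perm (Fin d)) : ℝ))⁻¹) •
            ∑ σ : Equiv.Perm (Fin d), (asum A (q + s) (permWord σ (boxVec L r - s)) - asum A q (treeWord (boxVec L r)))))
          - ∑ r : Fin d → Fin L, (((L : ℝ) ^ d)⁻¹) • ((((Fintype.card (Equiv.Perm (Fin d)) : ℝ))⁻¹) •
            ∑ σ : Equiv.Perm (Fin d), (asum A (q + (L : ℤ) • e κ + s) (permWord σ (boxVec L r - s))
              - asum A (q + (L : ℤ) • e κ) (treeWord (boxVec L r)))))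
        - (asum A (q + s) (seg κ L) - asum A q (seg κ L)))‖
      ≤ (expRem (2 * (Real.exp (((2 * (d * L + l1 s) + L + L : ℕ) : ℝ) * a) - 1)) + expRem (((2 * (d * L + l1 s) + L + L : ℕ) : ℝ) * a))
        + (expRem (2 * (Real.exp (((2 * (d * L) + L + L : ℕ) : ℝ) * a) - 1)) + expRem (((2 * (d * L) + L + L : ℕ) : ℝ) * a)) := by
  have h13 := X04_sub_Xhat_eq L hL A q s κ
  have h2 := norm_X04avg_sub_X04hat_le L hL V A q s κ ha hVAs hsmalls
  have h3 := norm_Xavg_sub_Xhat_le L hL V A q κ ha hVA hsmall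
  rw [← h13]
  -- `X04avg − X − (X̂04 − X̂) = (X04avg − X̂04) − (X − X̂)`
  have e : ∀ (X04avg X X04hat Xhat : 𝔸), X04avg - X - (X04hat - Xhat) = (X04avg - X04hat) - (X - Xhat) := fun _ _ _ _ => by abel
  rw [e]
  exact (norm_sub_le _ _).trans (add_le_add h2 h3)

end

end Summit.QuantumFields.YangMills.BalabanUVNodes.N16Eq04SameBlocksNonAbelian
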